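import Literature.NumberTheory.Automorphic.ShimuraCurveLocalUnitNorms
import Literature.NumberTheory.Automorphic.BrandtXi
import Literature.NumberTheory.Automorphic.BrandtModuleDictionary
import Literature.NumberTheory.Automorphic.DefiniteMaximalOrdersLeftOrderFibres
import Literature.NumberTheory.Automorphic.DefiniteOrderUnitsFinite
import Literature.NumberTheory.Automorphic.BrandtMatrixThetaSeries
import Literature.NumberTheory.Automorphic.BrandtThetaSeriesClassFunction
import Literature.NumberTheory.ModularForms.SiegelThetaMultiplierGaussSum
import Literature.NumberTheory.ModularForms.SiegelThetaMultiplierCyclotomic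
import Literature.NumberTheory.EllipticCurves.ModularFormsGamma0Genus
import Mathlib.NumberTheory.ModularForms.CuspFormSubmodule
import Mathlib.LinearAlgebra.Matrix.ToLin
import Literature.NumberTheory.Automorphic.BrandtSetupAdmissible
import HarnessLib
import Literature.NumberTheory.Automorphic.BrandtThetaSeriesHeckeAction
import Literature.NumberTheory.Automorphic.BrandtHeckeProjector
import Literature.NumberTheory.Automorphic.BrandtEigenvectorDegreeZero
import Literature.NumberTheory.Automorphic.EichlerSubidealCount
import Literature.NumberTheory.EllipticCurves.CongruenceNumber
import Literature.NumberTheory.EllipticCurves.HeckeCongruenceModulus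
import Literature.NumberTheory.EllipticCurves.NewformsMultiplicityOneProofs
import Literature.NumberTheory.EllipticCurves.NewformsHeckeProofs
import Literature.NumberTheory.EllipticCurves.NewformsRealCoefficients
import Summits.ABC.ABC.Theses.DefiniteXi
import Literature.NumberTheory.Automorphic.BrandtEigenvectorNonEisenstein
import Literature.NumberTheory.Automorphic.BrandtXiSetupIndependence
import Literature.NumberTheory.EllipticCurves.PastenSpectralDegreeProofs
import Literature.NumberTheory.EllipticCurves.PastenCongruenceModulusProofs
import Literature.NumberTheory.EllipticCurves.ModularDegreeMinimal
import Literature.NumberTheory.EllipticCurves.ModularCurveManinSemistableBridgeProofs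
import Literature.NumberTheory.EllipticCurves.SzpiroFreyConductorProofs
import Literature.NumberTheory.Automorphic.ShimuraCurveRibetTakahashiCokernelProofs
import Literature.NumberTheory.EllipticCurves.PastenValuationProductThm75MultiplicityProofs

/-!
# Xi helper 5 — the theta lift K1–K3 and the kernel templates (T), (H4a′), (H4b′), (O) as statements (k1 G10, first part; `H1` as a named statement)

Helper module 5/10 for the registered stub `stub_xiDegreeComparison` of the line `p6_tamagawa_split` (crux `DefiniteXi.SteinbergCore`, item stmt-ABC-15024, route `route-ABC-DefiniteXi`).  Content = lines 1470–1735, 2058–2070 of `Summits/ABC/ABC/Cruxes/SteinbergCore/STUB_PLAN_stub_xiDegreeComparison_XiMono.lean` (the renamespaced k1 gen-11 certificate `STUB_IDEAS_stub_xiDegreeComparison_1_g11_Certificate.lean`: k1 gens 7–11, k2 gen-4 kernel, k3 gen-4 tail — authors: stub-ideation seats k1/k2/k3), cut mechanically at declaration boundaries by the stub-critic (plan `STUB-PLAN-stub_xiDegreeComparison.md` §1).  Proofs verbatim; nothing restated.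
-/

set_option linter.dupNamespace false

noncomputable section

namespace Summit.ABC.ABC.Theorems.SteinbergCoreXi.StubIdeasK1G10

open scoped MatrixGroups ModularForm Matrix
open CongruenceSubgroup
open Literature.NumberTheory.EllipticCurves Literature.NumberTheory.EllipticCurves.ModularForms
open Literature.NumberTheory.Automorphic Literature.NumberTheory.Automorphic.Brandt

/-! ## §1 H1 — differences of Brandt theta series are cusp forms (PROVED, k1 gen 9) -/

/-- **H1** verbatim (= `StubIdeasK1G9.thetaTransfer_H1` = k2 `ThetaTransferG3.brandtTheta_sub_isCuspForm`):
`Θ_ij − Θ_kl ∈ S₂(Γ₀(N⁺N⁻))`.  PROVED in `STUB_IDEAS_stub_xiDegreeComparison_1_g9_H1complete.lean`. -/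
def H1 : Prop :=
  ∀ (Nplus Nminus : ℕ) (S : XiSetup Nplus Nminus) [Fintype (ClassSet S.O)] (i j k l : ClassSet S.O),
    ModularForm.IsCuspForm (S.brandtTheta i j - S.brandtTheta k l)

variable {Nplus Nminus : ℕ}

/-! ## §2 K1 — degree-zero combinations of one theta row are cuspidal (PROVED from H1) -/

/-- **K1 (XS, PROVED).** `Σ_j v_j = 0 ⟹ Σ_j v_j Θ_ij ∈ S₂(Γ₀(N⁺N⁻))`:
`Σ_j v_j Θ_ij = Σ_j v_j (Θ_ij − Θ_ii)` and the cusp forms are a submodule. [folklore] -/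
theorem isCuspForm_sum_smul_brandtTheta (hΘ : H1) (S : XiSetup Nplus Nminus)
    [Fintype (ClassSet S.O)] (i : ClassSet S.O) {v : ClassSet S.O → ℤ} (hv : ∑ j, v j = 0) :
    ModularForm.IsCuspForm (∑ j, (v j : ℂ) • S.brandtTheta i j) := by
  have h0 : ∑ j, (v j : ℂ) • S.brandtTheta i i = 0 := by
    rw [← Finset.sum_smul, ← Int.cast_sum, hv, Int.cast_zero, zero_smul]
  have h : ∑ j, (v j : ℂ) • S.brandtTheta i j =
      ∑ j, (v j : ℂ) • (S.brandtTheta i j - S.brandtTheta i i) := by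
    simp_rw [smul_sub, Finset.sum_sub_distrib, h0, sub_zero]
  rw [h, ← ModularForm.mem_cuspFormSubmodule_iff]
  exact Submodule.sum_mem _ fun j _ => Submodule.smul_mem _ _ (hΘ Nplus Nminus S i j i i)

/-- From `IsCuspForm` to an honest `CuspForm` with the same underlying modular form
(`IsCuspForm f := f ∈ range toModularFormₗ`, definitional). [folklore] -/
theorem exists_cuspForm_of_isCuspForm {Γ : Subgroup (GL (Fin 2) ℝ)} [Γ.HasDetOne] {k : ℤ}
    {f : ModularForm Γ k} (h : ModularForm.IsCuspForm f) :
    ∃ g : CuspForm Γ k, (g : ModularForm Γ k) = f := h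

/-! ## §3 K2 — the row theta lift `Θ_i : ℤ[Cls O]⁰ → S₂(Γ₀(N⁺N⁻))` and its package -/

/-- **The row theta lift** `Θ_i(v) = Σ_j v_j Θ_ij` for `deg v = 0` (junk `0` off the degree-zero
lattice) — the `Θ` fed to k2's transfer template (T). [folklore] -/
def thetaLift (hΘ : H1) (S : XiSetup Nplus Nminus) [Fintype (ClassSet S.O)] (i : ClassSet S.O)
    (v : ClassSet S.O → ℤ) : CuspForm (Gamma0 (Nplus * Nminus)) 2 :=
  if hv : ∑ j, v j = 0 then
    (exists_cuspForm_of_isCuspForm (isCuspForm_sum_smul_brandtTheta hΘ S i hv)).choose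
  else 0

/-- **K2a (PROVED).** The underlying modular form of `Θ_i(v)` is `Σ_j v_j Θ_ij`. [folklore] -/
theorem coe_thetaLift (hΘ : H1) (S : XiSetup Nplus Nminus) [Fintype (ClassSet S.O)]
    (i : ClassSet S.O) {v : ClassSet S.O → ℤ} (hv : ∑ j, v j = 0) :
    ((thetaLift hΘ S i v : CuspForm (Gamma0 (Nplus * Nminus)) 2) :
        ModularForm (Gamma0 (Nplus * Nminus)) 2) = ∑ j, (v j : ℂ) • S.brandtTheta i j := by
  rw [thetaLift, dif_pos hv]
  exact (exists_cuspForm_of_isCuspForm (isCuspForm_sum_smul_brandtTheta hΘ S i hv)).choose_spec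

/-- Two cusp forms with the same underlying modular form are equal. [folklore] -/
theorem cuspForm_eq_of_coe_eq {Γ : Subgroup (GL (Fin 2) ℝ)} [Γ.HasDetOne] {k : ℤ}
    {g g' : CuspForm Γ k} (h : (g : ModularForm Γ k) = (g' : ModularForm Γ k)) : g = g' :=
  CuspForm.toModularFormₗ_injective h

/-- **K2b (XS, PROVED).** Additivity on the degree-zero lattice. [folklore] -/
theorem thetaLift_add (hΘ : H1) (S : XiSetup Nplus Nminus) [Fintype (ClassSet S.O)]
    (i : ClassSet S.O) (v v' : ClassSet S.O → ℤ) (hv : ∑ c, v c = 0) (hv' : ∑ c, v' c = 0) :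
    thetaLift hΘ S i (v + v') = thetaLift hΘ S i v + thetaLift hΘ S i v' := by
  have hvv' : ∑ c, (v + v') c = 0 := by
    simp only [Pi.add_apply, Finset.sum_add_distrib, hv, hv', add_zero]
  apply CuspForm.toModularFormₗ_injective
  rw [map_add, CuspForm.toModularFormₗ_eq_coe, CuspForm.toModularFormₗ_eq_coe,
    CuspForm.toModularFormₗ_eq_coe, coe_thetaLift hΘ S i hvv', coe_thetaLift hΘ S i hv,
    coe_thetaLift hΘ S i hv', ← Finset.sum_add_distrib]
  refine Finset.sum_congr rfl fun j _ => ?_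
  rw [Pi.add_apply, Int.cast_add, add_smul]

/-- **K2c (XS, PROVED).** `ℤ`-homogeneity on the degree-zero lattice. [folklore] -/
theorem thetaLift_smul (hΘ : H1) (S : XiSetup Nplus Nminus) [Fintype (ClassSet S.O)]
    (i : ClassSet S.O) (a : ℤ) (v : ClassSet S.O → ℤ) (hv : ∑ c, v c = 0) :
    thetaLift hΘ S i (a • v) = (a : ℂ) • thetaLift hΘ S i v := by
  have hav : ∑ c, (a • v) c = 0 := by
    simp only [Pi.smul_apply, smul_eq_mul, ← Finset.mul_sum, hv, mul_zero]
  apply CuspForm.toModularFormₗ_injective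
  rw [map_smul, CuspForm.toModularFormₗ_eq_coe, CuspForm.toModularFormₗ_eq_coe,
    coe_thetaLift hΘ S i hav, coe_thetaLift hΘ S i hv, Finset.smul_sum]
  refine Finset.sum_congr rfl fun j _ => ?_
  rw [Pi.smul_apply, smul_eq_mul, Int.cast_mul, smul_smul]

/-- **K2g (XS, PROVED).** `T(p)`, `p ∤ N⁺N⁻`, preserves the degree-zero lattice: the columns of
`T(p)` sum to `p + 1` (tree `XiSetup.sum_matrix_prime_eq`). [cite: Eichler1973, Ch. II §6 (16)] -/
theorem sum_matrix_mulVec_eq_zero (S : XiSetup Nplus Nminus) [Fintype (ClassSet S.O)] {p : ℕ}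
    (hp : p.Prime) (hpN : ¬ p ∣ Nplus * Nminus) {v : ClassSet S.O → ℤ} (hv : ∑ c, v c = 0) :
    ∑ c, (matrix S.O p *ᵥ v) c = 0 := by
  simp only [Matrix.mulVec, dotProduct]
  rw [Finset.sum_comm]
  simp_rw [← Finset.sum_mul, S.sum_matrix_prime_eq hp hpN, ← Finset.mul_sum, hv, mul_zero]

/-- **K2d (PROVED).** Fourier coefficients of the lift: `a_n(Θ_i v) = 2 w_i (T(n) v)_i` for `n ≥ 1`
(tree `XiSetup.qExpansion_coeff_sum_smul_brandtTheta` through `coe_thetaLift`; `cuspCoeff` is the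
`q`-expansion coefficient of the SAME function `⇑(Θ_i v) = ⇑(↑(Θ_i v) : ModularForm)`).
[cite: Voight2021, §41.1 (p. 752) and 41.1.3] -/
theorem cuspCoeff_thetaLift (hΘ : H1) (S : XiSetup Nplus Nminus) [Fintype (ClassSet S.O)]
    (i : ClassSet S.O) {v : ClassSet S.O → ℤ} (hv : ∑ j, v j = 0) {n : ℕ} (hn : n ≠ 0) :
    cuspCoeff (thetaLift hΘ S i v) n = ((2 * (weight S.O i : ℤ) * (matrix S.O n *ᵥ v) i : ℤ) : ℂ) := by
  have hcoe : ⇑(thetaLift hΘ S i v) =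
      ⇑(((thetaLift hΘ S i v : CuspForm (Gamma0 (Nplus * Nminus)) 2) :
        ModularForm (Gamma0 (Nplus * Nminus)) 2)) := rfl
  rw [cuspCoeff, hcoe, coe_thetaLift hΘ S i hv,
    S.qExpansion_coeff_sum_smul_brandtTheta i (fun j => (v j : ℂ)) hn, XiSetup.heckeFamily_apply]
  simp only [Matrix.mulVec, dotProduct, Matrix.map_apply, Int.coe_castRingHom]
  push_cast
  rfl

/-- **K2d₀ (PROVED).** `a_0(Θ_i v) = deg v = 0` (tree `XiSetup.qExpansion_coeff_zero_sum_smul_brandtTheta`). [folklore] -/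
theorem cuspCoeff_thetaLift_zero (hΘ : H1) (S : XiSetup Nplus Nminus) [Fintype (ClassSet S.O)]
    (i : ClassSet S.O) {v : ClassSet S.O → ℤ} (hv : ∑ j, v j = 0) :
    cuspCoeff (thetaLift hΘ S i v) 0 = 0 := by
  have hcoe : ⇑(thetaLift hΘ S i v) =
      ⇑(((thetaLift hΘ S i v : CuspForm (Gamma0 (Nplus * Nminus)) 2) :
        ModularForm (Gamma0 (Nplus * Nminus)) 2)) := rfl
  rw [cuspCoeff, hcoe, coe_thetaLift hΘ S i hv,
    S.qExpansion_coeff_zero_sum_smul_brandtTheta i (fun j => (v j : ℂ)), ← Int.cast_sum, hv,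
    Int.cast_zero]

/-- **K2e (PROVED).** Integrality: `Θ_i v ∈ S₂(Γ₀(N⁺N⁻); ℤ)` (from K2d, K2d₀). [folklore] -/
theorem thetaLift_mem_integralCuspForms0 (hΘ : H1) (S : XiSetup Nplus Nminus)
    [Fintype (ClassSet S.O)] (i : ClassSet S.O) {v : ClassSet S.O → ℤ} (hv : ∑ j, v j = 0) :
    thetaLift hΘ S i v ∈ integralCuspForms0 (Nplus * Nminus) 2 := by
  rw [mem_integralCuspForms0]
  intro n
  rcases eq_or_ne n 0 with rfl | hn
  · exact ⟨0, by rw [cuspCoeff_thetaLift_zero hΘ S i hv, Int.cast_zero]⟩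
  · exact ⟨_, (cuspCoeff_thetaLift hΘ S i hv hn).symm⟩

/-- **K2f (PROVED).** `T_p`-equivariance for `p ∤ N⁺N⁻`: `T_p (Θ_i v) = Θ_i (T(p) v)`
(tree `XiSetup.modHeckeT_sum_smul_brandtTheta` + `coe_modHeckeT_coe_cuspForm` + `coe_thetaLift`
twice, the second time at `T(p) v`, degree zero by K2g; `heckeFamily p (v ↦ ↑v_j) = ↑(T(p) v)` by
`XiSetup.heckeFamily_apply`). [cite: Pizer1980, §2 Prop. 2.23 and Remark 2.24] -/
theorem heckeT_thetaLift (hΘ : H1) (S : XiSetup Nplus Nminus) [Fintype (ClassSet S.O)]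
    [NeZero (Nplus * Nminus)] (i : ClassSet S.O) {p : ℕ} (hp : p.Prime)
    (hpN : ¬ p ∣ Nplus * Nminus) {v : ClassSet S.O → ℤ} (hv : ∑ c, v c = 0) :
    (haveI : NeZero p := ⟨hp.ne_zero⟩;
      heckeT (Gamma0 (Nplus * Nminus)) 2 p (thetaLift hΘ S i v)) =
      thetaLift hΘ S i (matrix S.O p *ᵥ v) := by
  haveI : NeZero p := ⟨hp.ne_zero⟩
  have hTv : ∑ c, (matrix S.O p *ᵥ v) c = 0 := sum_matrix_mulVec_eq_zero S hp hpN hv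
  refine DFunLike.coe_injective ?_
  have h1 : ⇑(heckeT (Gamma0 (Nplus * Nminus)) 2 p (thetaLift hΘ S i v)) =
      ⇑(modHeckeT (Gamma0 (Nplus * Nminus)) 2 p
        ((thetaLift hΘ S i v : CuspForm (Gamma0 (Nplus * Nminus)) 2) :
          ModularForm (Gamma0 (Nplus * Nminus)) 2)) :=
    (coe_modHeckeT_coe_cuspForm 2 p _).symm
  have h2 : ⇑(thetaLift hΘ S i (matrix S.O p *ᵥ v)) =
      ⇑(((thetaLift hΘ S i (matrix S.O p *ᵥ v) : CuspForm (Gamma0 (Nplus * Nminus)) 2) :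
        ModularForm (Gamma0 (Nplus * Nminus)) 2)) := rfl
  change ⇑(heckeT (Gamma0 (Nplus * Nminus)) 2 p (thetaLift hΘ S i v)) =
    ⇑(thetaLift hΘ S i (matrix S.O p *ᵥ v))
  rw [h1, h2, coe_thetaLift hΘ S i hv, coe_thetaLift hΘ S i hTv,
    S.modHeckeT_sum_smul_brandtTheta i hp hpN (fun j => (v j : ℂ))]
  congr 1
  refine Finset.sum_congr rfl fun k _ => ?_
  congr 1
  simp only [XiSetup.heckeFamily_apply, Matrix.mulVec, dotProduct, Matrix.map_apply,
    Int.coe_castRingHom]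
  push_cast
  rfl

/-! ## §4 K3 = H3 — the lift of the `a(E)`-eigenvector is `2 w_i φ_i · f` (multiplicity one) -/

/-- **K3 (PROVED).** If `f` is the newform of `W` at level `N⁺N⁻` and `φ` lies in the `a(W)`-eigen-lattice
of the Brandt matrices, then `Θ_i(φ) = (2 w_i φ_i) • f`.  Route: `deg φ = 0`
(`XiSetup.sum_eq_zero_of_mem_eigenLattice_lFunction'`); `T_p (Θ_i φ) = a_p • Θ_i φ` for `p ∤ N⁺N⁻`
(K2f + `hφ` + K2c); `T_p f = a_p • f` (`IsNewform0.heckeT_eq_coeff_smul` + `hf.2 p`); strong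
multiplicity one `mem_span_of_equiv_of_mem_newSubspace0 (IsNormalized.ne_zero_gamma0 hf.1.2.2) hf.1.1`
⟹ `Θ_i φ = c • f`; `a₁(Θ_i φ) = 2 w_i φ_i` (K2d at `n = 1`, `matrix_one`), `a₁(f) = 1`.
[cite: Knapp1993, Thm. 9.22] [cite: DiamondShurman2005, Prop. 5.8.5] -/
theorem thetaLift_eq_smul_of_isNewformOf (hΘ : H1) (S : XiSetup Nplus Nminus)
    [Fintype (ClassSet S.O)] [NeZero (Nplus * Nminus)] (i : ClassSet S.O)
    (W : WeierstrassCurve ℚ) [W.IsElliptic] {f : CuspForm (Gamma0 (Nplus * Nminus)) 2}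
    (hf : IsNewformOf W f) {φ : ClassSet S.O → ℤ}
    (hφ : φ ∈ eigenLattice (Nplus * Nminus) (matrix S.O) fun n => W.LFunction n) :
    thetaLift hΘ S i φ = ((2 * (weight S.O i : ℤ) * φ i : ℤ) : ℂ) • f := by
  classical
  have hφdeg : ∑ c, φ c = 0 := S.sum_eq_zero_of_mem_eigenLattice_lFunction' W hφ
  have hf0 : f ≠ 0 := IsNormalized.ne_zero_gamma0 hf.1.2.2
  -- `T_p f = a_p(W) f` away from the level (newform + `aₙ(f) = aₙ(W)`)
  have hfT : ∀ (p : ℕ) (hp : p.Prime), ¬ p ∣ Nplus * Nminus →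
      (haveI : NeZero p := ⟨hp.ne_zero⟩; heckeT (Gamma0 (Nplus * Nminus)) 2 p f) =
        (fun n : ℕ => (W.LFunction n : ℂ)) p • f := by
    intro p hp _
    haveI : NeZero p := ⟨hp.ne_zero⟩
    rw [hf.1.heckeT_eq_coeff_smul hp]
    exact congrArg (· • f) (hf.2 p)
  -- `T_p (Θ_i φ) = a_p(W) Θ_i φ` (K2f + eigenvector + K2c)
  have hg : ∀ (p : ℕ) (hp : p.Prime), ¬ p ∣ Nplus * Nminus →
      (haveI : NeZero p := ⟨hp.ne_zero⟩;
        heckeT (Gamma0 (Nplus * Nminus)) 2 p (thetaLift hΘ S i φ)) =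
        (fun n : ℕ => (W.LFunction n : ℂ)) p • thetaLift hΘ S i φ := by
    intro p hp hpN
    have h := heckeT_thetaLift hΘ S i hp hpN hφdeg
    rw [hφ p hp hpN, thetaLift_smul hΘ S i _ φ hφdeg] at h
    exact h
  -- strong multiplicity one: `Θ_i φ = c • f`
  obtain ⟨c, hc⟩ := Submodule.mem_span_singleton.mp
    (mem_span_of_equiv_of_mem_newSubspace0 hf0 hf.1.1 hfT (thetaLift hΘ S i φ) hg)
  -- compare `a₁`: `a₁(Θ_i φ) = 2 w_i φ_i`, `a₁(c f) = c`
  have h1 : cuspCoeff (thetaLift hΘ S i φ) 1 = ((2 * (weight S.O i : ℤ) * φ i : ℤ) : ℂ) := by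
    rw [cuspCoeff_thetaLift hΘ S i hφdeg one_ne_zero, matrix_one S.O, Matrix.one_mulVec]
  have h2 : cuspCoeff (thetaLift hΘ S i φ) 1 = c := by
    have h3 : (UpperHalfPlane.qExpansion 1 ⇑f).coeff 1 = 1 := hf.1.2.2
    rw [← hc, cuspCoeff, qExpansion_coeff_smul, h3, mul_one]
  rw [← hc, ← h2, h1]

/-! ## §5 k2's PROVED kernel, recorded as `Prop`s (verbatim `ThetaTransferG4`, gen 4) -/

/-- **(β)+(T)** = `ThetaTransferG4.dvd_natAbs_mul_congruenceNumber_of_transfer` (PROVED). -/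
def KernelT : Prop :=
  ∀ (ι : Type) [Fintype ι] (N : ℕ) [NeZero N] (k : ℤ) (w : ι → ℕ) (φ : ι → ℤ) (ξ : ℕ), ξ ≠ 0 →
    ξ = ∑ c, w c * (φ c).natAbs ^ 2 → ∑ c, φ c = 0 →
    ∀ (f : CuspForm (Gamma0 N) k), f ≠ 0 → f ∈ integralCuspForms0 N k →
    ∀ (Θ : (ι → ℤ) → CuspForm (Gamma0 N) k),
      (∀ v v' : ι → ℤ, ∑ c, v c = 0 → ∑ c, v' c = 0 → Θ (v + v') = Θ v + Θ v') →
      (∀ (a : ℤ) (v : ι → ℤ), ∑ c, v c = 0 → Θ (a • v) = (a : ℂ) • Θ v) →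
      (∀ v : ι → ℤ, ∑ c, v c = 0 → Θ v ∈ integralCuspForms0 N k) →
    ∀ (m : ℤ), Θ φ = (m : ℂ) • f →
      (∀ z : ι → ℤ, ∑ c, z c = 0 → ∑ c, (w c : ℤ) * φ c * z c = 0 →
        peterssonProduct (Gamma0 N) k f (Θ z) = 0) →
    ∀ (y : ι → ℤ), ∑ c, y c = 0 →
      ξ ∣ (m * ∑ c, (w c : ℤ) * φ c * y c).natAbs * congruenceNumber f

/-- **H4a′** = `ThetaTransferG4.peterssonProduct_anemicHecke_symm` (PROVED). -/
def SelfAdjH4a : Prop :=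
  ∀ (N : ℕ) [NeZero N] (k : ℤ) (t : anemicHeckeRing N k) (f g : CuspForm (Gamma0 N) k),
    peterssonProduct (Gamma0 N) k ((t : Module.End ℂ (CuspForm (Gamma0 N) k)) f) g =
      peterssonProduct (Gamma0 N) k f ((t : Module.End ℂ (CuspForm (Gamma0 N) k)) g)

/-- **H4b′** = `ThetaTransferG4.exists_anemicHecke_transport` (PROVED). -/
def TransportH4b : Prop :=
  ∀ (ι : Type) [Fintype ι] [DecidableEq ι] (N : ℕ) [NeZero N] (k : ℤ) (T : ℕ → Matrix ι ι ℤ)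
    (Θ : (ι → ℤ) → CuspForm (Gamma0 N) k),
    (∀ p : ℕ, p.Prime → ¬ p ∣ N → ∀ v : ι → ℤ, ∑ c, v c = 0 → ∑ c, (T p *ᵥ v) c = 0) →
    (∀ v v' : ι → ℤ, ∑ c, v c = 0 → ∑ c, v' c = 0 → Θ (v + v') = Θ v + Θ v') →
    (∀ (a : ℤ) (v : ι → ℤ), ∑ c, v c = 0 → Θ (a • v) = (a : ℂ) • Θ v) →
    (∀ (p : ℕ) (hp : p.Prime), ¬ p ∣ N → ∀ v : ι → ℤ, ∑ c, v c = 0 →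
      (haveI : NeZero p := ⟨hp.ne_zero⟩; heckeT (Gamma0 N) k p (Θ v)) = Θ (T p *ᵥ v)) →
    ∀ (M : Matrix ι ι ℤ),
      M ∈ Algebra.adjoin ℤ {X : Matrix ι ι ℤ | ∃ p : ℕ, p.Prime ∧ ¬ p ∣ N ∧ X = T p} →
    ∃ t : anemicHeckeRing N k, ∀ v : ι → ℤ, ∑ c, v c = 0 →
      (t : Module.End ℂ (CuspForm (Gamma0 N) k)) (Θ v) = Θ (M *ᵥ v)

/-- **(O)** = `ThetaTransferG4.peterssonProduct_transfer_eq_zero` (PROVED). -/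
def OrthO : Prop :=
  ∀ (ι : Type) [Fintype ι] [DecidableEq ι] (N : ℕ) [NeZero N] (k : ℤ) (w : ι → ℕ) (φ : ι → ℤ)
    (ξ D : ℕ), ξ ≠ 0 → 0 < D → ξ = ∑ c, w c * (φ c).natAbs ^ 2 →
    ∀ (M : Matrix ι ι ℤ), (∀ c d : ι, (ξ : ℤ) * M c d = (D : ℤ) * (w d : ℤ) * φ d * φ c) →
    ∀ (f : CuspForm (Gamma0 N) k) (Θ : (ι → ℤ) → CuspForm (Gamma0 N) k),
      (∀ (a : ℤ) (v : ι → ℤ), ∑ c, v c = 0 → Θ (a • v) = (a : ℂ) • Θ v) →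
    ∀ (t : anemicHeckeRing N k),
      (∀ v : ι → ℤ, ∑ c, v c = 0 →
        (t : Module.End ℂ (CuspForm (Gamma0 N) k)) (Θ v) = Θ (M *ᵥ v)) →
      (∀ g g' : CuspForm (Gamma0 N) k,
        peterssonProduct (Gamma0 N) k ((t : Module.End ℂ (CuspForm (Gamma0 N) k)) g) g' =
          peterssonProduct (Gamma0 N) k g ((t : Module.End ℂ (CuspForm (Gamma0 N) k)) g')) →
    ∑ c, φ c = 0 → ∀ (m : ℤ), m ≠ 0 → Θ φ = (m : ℂ) • f →
    ∀ (z : ι → ℤ), ∑ c, z c = 0 → ∑ c, (w c : ℤ) * φ c * z c = 0 →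
      peterssonProduct (Gamma0 N) k f (Θ z) = 0



/-! ### Statements used downstream (moved here unchanged from a later section of the source so that every new `def` lands in a round-1 module; docstrings verbatim) -/

/-! ## §6 K5 — the composition into k3's `XiCoreDivisibility` (the interface test) -/

/-- k3 `ProbeExtremesG4.XiCoreDivisibility`, VERBATIM. -/
def XiCoreDivisibility : Prop :=
  ∀ (Nplus Nminus M : ℕ) [NeZero M], Nplus * Nminus = M →
    ∀ (S : XiSetup Nplus Nminus) [Fintype (ClassSet S.O)] (W : WeierstrassCurve ℚ) [W.IsElliptic]
      (f : CuspForm (Gamma0 M) 2), IsNewformOf W f →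
    ∀ (φ : ClassSet S.O → ℤ), φ ≠ 0 →
      eigenLattice (Nplus * Nminus) (matrix S.O) (fun n => W.LFunction n) = ℤ ∙ φ →
    ∀ (i : ClassSet S.O) (y : ClassSet S.O → ℤ), ∑ c, y c = 0 →
      (S.xi fun n => W.LFunction n) ∣
        (2 * (weight S.O i : ℤ) * φ i * ∑ c, (weight S.O c : ℤ) * φ c * y c).natAbs *
          congruenceNumber f
end Summit.ABC.ABC.Theorems.SteinbergCoreXi.StubIdeasK1G10

end
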